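import Summits.Parity.GeneralizedHardyLittlewood.Theorems.GreenTaoLevelTwoGITwoCyclicInverseSymmetryFront
import Summits.Parity.GeneralizedHardyLittlewood.Theorems.GreenTaoLevelTwoGITwoCyclicInverseSymmetryFrontZ
import Summits.Parity.GeneralizedHardyLittlewood.Theorems.GreenTaoLevelTwoGITwoCyclicInverseSymmetryPopular
import Summits.Parity.GeneralizedHardyLittlewood.Theorems.GreenTaoLevelTwoGITwoCyclicInverseSymmetryEndgame
import Summits.Parity.GeneralizedHardyLittlewood.Theorems.GreenTaoLevelTwoGITwoCyclicInverseBohrRegular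

/-!
# Route `GreenTaoLevelTwo`, crux `GITwo` (stmt-Parity-21275), line `birth`, stub `stub_cyclicInverse`:
# symmetry of the derivative (GT08a arXiv Lemma 46, assembled)

Forty-sixth helper file toward the XL stub `stub_cyclicInverse` (B. Green, T. Tao, *An inverse
theorem for the Gowers `U³(G)` norm*, arXiv:math/0503014, Thm. 68 = PEMS 51 (2008) Thm. 12.8).
Block C12: arXiv Lemma 46 assembled from its four landed parts — `exists_translate_sq_sum_ge`
((eq9.72) ⇒ (eq9.74)), `exists_bilinear_phase_average` ((eq9.74) ⇒ (eq9.75')),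
`exists_popular_difference` ((eq9.75') ⇒ popular difference), `symmetry_endgame` (⇒ (sym)) — with
the small regular Bohr set `B₂ = B(S,ρ₂)` supplied by `exists_regular_bohr` (arXiv Lemma 36).
Input: the correlation (eq9.72) `κ N #B₁ ≤ Σ_{h∈B₁} |Σ_x c₂(x+h) c₃(x) e(−μ(h)x)|` for
`B₁ = B(S,ρ₁)` regular, `ρ₁ ≤ 1/8`, `μ` additive on `B(S,¼)` (this is the shape delivered by
arXiv Prop. 45 `exists_locally_linear_correlation` after unfolding `dftCoeff`).  Output (sym): radii
`ρ₂, ρ'`, a finset `F`, all with explicit polynomial bounds in `κ, d`, such that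
`‖{x,z}‖ ≤ 2²⁰ d t/(ρ₂ κ⁸)` for all `x` with `‖x‖_S ≤ t` and all `z ∈ B(S ∪ F, ·)`.

* `symmetry_of_derivative` — **arXiv Lemma 46** in the form just described;
* `norm_sum_deriv_eq_mul_norm_dftCoeff` — the bridge from the `dftCoeff` form of arXiv Prop. 45
  (`exists_locally_linear_correlation`) to the input (eq9.72).

References: [GreenTao2008U3Inverse] arXiv:math/0503014, Lemma 46.
-/

noncomputable section

namespace Summit.Parity.GeneralizedHardyLittlewood.GreenTaoLevelTwoGITwoCyclicInverse

open Finset ZMod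
open scoped ComplexConjugate

open Literature.NumberTheory.Sieve

variable {N : ℕ} [NeZero N]

/-- **Symmetry of the derivative (GT08a arXiv Lemma 46), assembled.**  Let `S` be nonempty
(`d = #S`), `0 < ρ₁ ≤ 1/8` with `B₁ = B(S,ρ₁)` regular, `μ : ℤ/Nℤ → ℤ/Nℤ` additive on `B(S,¼)`,
`0 < κ ≤ 1`, and `c₂, c₃` weights bounded by `1` with
`κ N #B₁ ≤ Σ_{h∈B₁} |Σ_x c₂(x+h) c₃(x) e(−μ(h)x/N)|`.  Then there are radii `ρ₂ ≥ κ²ρ₁/(1600d)`,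
`ρ' ≥ (κ⁴/8)ρ₂/(800d)` and a finset `F` with `#F ≤ 128/(κ⁴/8)⁴` such that for every `t > 0`, every
`x` with `‖xξ‖ ≤ t` (`ξ ∈ S`) and every `z` with `‖zξ‖ < (κ⁴/8)⁸ρ'/(2³²d)` (`ξ ∈ S`), `‖zζ‖ ≤ 1/12`
(`ζ ∈ F`): `‖toAddCircle(μ(x)z) − toAddCircle(μ(z)x)‖ ≤ 4·2¹² d t/(ρ₂ (κ⁴/8)²)`.
[cite: GreenTao2008U3Inverse, Lemma 46] -/
theorem symmetry_of_derivative (S : Finset (ZMod N)) (hS : S.Nonempty) {ρ₁ κ : ℝ}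
    (hρ₁ : 0 < ρ₁) (hρ₁8 : ρ₁ ≤ 1 / 8) (hκ : 0 < κ) (hκ1 : κ ≤ 1)
    (hreg₁ : ∀ r : ℝ, |r| ≤ 1 / (100 * (#S : ℝ)) →
      (1 - 100 * (#S : ℝ) * |r|) * #{x : ZMod N | ∀ ξ ∈ S, ‖ZMod.toAddCircle (x * ξ)‖ < ρ₁} ≤
          #{x : ZMod N | ∀ ξ ∈ S, ‖ZMod.toAddCircle (x * ξ)‖ < (1 + r) * ρ₁} ∧
        (#{x : ZMod N | ∀ ξ ∈ S, ‖ZMod.toAddCircle (x * ξ)‖ < (1 + r) * ρ₁} : ℝ) ≤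
          (1 + 100 * (#S : ℝ) * |r|) * #{x : ZMod N | ∀ ξ ∈ S, ‖ZMod.toAddCircle (x * ξ)‖ < ρ₁})
    {μ : ZMod N → ZMod N}
    (hadd : ∀ h₁ h₂ : ZMod N, (∀ ξ' ∈ S, ‖ZMod.toAddCircle (h₁ * ξ')‖ ≤ 1 / 4) →
      (∀ ξ' ∈ S, ‖ZMod.toAddCircle (h₂ * ξ')‖ ≤ 1 / 4) →
      (∀ ξ' ∈ S, ‖ZMod.toAddCircle ((h₁ + h₂) * ξ')‖ ≤ 1 / 4) → μ (h₁ + h₂) = μ h₁ + μ h₂)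
    (c₂ c₃ : ZMod N → ℂ) (hc₂ : ∀ x, ‖c₂ x‖ ≤ 1) (hc₃ : ∀ x, ‖c₃ x‖ ≤ 1)
    (hbig : κ * N * #{x : ZMod N | ∀ ξ ∈ S, ‖ZMod.toAddCircle (x * ξ)‖ < ρ₁} ≤
      ∑ h ∈ ({x : ZMod N | ∀ ξ ∈ S, ‖ZMod.toAddCircle (x * ξ)‖ < ρ₁} : Finset (ZMod N)),
        ‖∑ x : ZMod N, c₂ (x + h) * c₃ x * stdAddChar (-(μ h * x))‖) :
    ∃ (ρ₂ ρ' : ℝ) (F : Finset (ZMod N)),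
      κ ^ 2 * ρ₁ / (1600 * (#S : ℝ)) ≤ ρ₂ ∧ (κ ^ 4 / 8) / (800 * (#S : ℝ)) * ρ₂ ≤ ρ' ∧
      (#F : ℝ) ≤ 128 / (κ ^ 4 / 8) ^ 4 ∧
      ∀ (t : ℝ), 0 < t → ∀ x : ZMod N, (∀ ξ ∈ S, ‖ZMod.toAddCircle (x * ξ)‖ ≤ t) →
        ∀ z : ZMod N, (∀ ξ ∈ S, ‖ZMod.toAddCircle (z * ξ)‖ <
            (κ ^ 4 / 8) ^ 8 / (2 ^ 32 * (#S : ℝ)) * ρ') →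
          (∀ ζ ∈ F, ‖ZMod.toAddCircle (z * ζ)‖ ≤ 1 / 12) →
            ‖ZMod.toAddCircle (μ x * z) - ZMod.toAddCircle (μ z * x)‖ ≤
              4 * (2 ^ 12 * (#S : ℝ) * t / (ρ₂ * (κ ^ 4 / 8) ^ 2)) := by
  classical
  have hd1 : (1 : ℝ) ≤ #S := by exact_mod_cast Nat.one_le_iff_ne_zero.mpr (card_pos.mpr hS).ne'
  -- the small regular Bohr set `B₂ = B(S, ρ₂)`
  set ε₂ : ℝ := κ ^ 2 * ρ₁ / (1600 * (#S : ℝ)) with hε₂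
  have hε₂0 : 0 < ε₂ := by positivity
  obtain ⟨ρ₂, hρ₂1, hρ₂2, hreg₂⟩ := exists_regular_bohr S (ε := ε₂) hε₂0
  have hρ₂0 : 0 < ρ₂ := lt_of_lt_of_le hε₂0 hρ₂1
  have hsmall : 800 * (#S : ℝ) * ρ₂ ≤ κ ^ 2 * ρ₁ := by
    have : 800 * (#S : ℝ) * (2 * ε₂) = κ ^ 2 * ρ₁ := by rw [hε₂]; field_simp; ring
    rw [← this]
    exact mul_le_mul_of_nonneg_left hρ₂2 (by positivity)
  have hρ₂64 : ρ₂ ≤ 1 / 64 := by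
    have h1 : κ ^ 2 ≤ 1 := by nlinarith
    have h2 : κ ^ 2 * ρ₁ ≤ 1 * (1 / 8) := mul_le_mul h1 hρ₁8 hρ₁.le zero_le_one
    have h3 : 800 * ρ₂ ≤ 800 * (#S : ℝ) * ρ₂ := by nlinarith
    linarith
  set B₂ : Finset (ZMod N) := {x : ZMod N | ∀ ξ ∈ S, ‖ZMod.toAddCircle (x * ξ)‖ < ρ₂} with hB₂
  have hB₂mem : ∀ x, x ∈ B₂ → ∀ ξ ∈ S, ‖ZMod.toAddCircle (x * ξ)‖ < ρ₂ := fun x hx => by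
    rw [hB₂, mem_filter] at hx; exact hx.2
  have hB₂ne : B₂.Nonempty := by
    rw [← card_pos]
    exact one_le_card_bohr S hρ₂0
  -- Step A: (eq9.72) ⇒ (eq9.74)
  obtain ⟨x₁, hA⟩ := exists_translate_sq_sum_ge _ B₂ hB₂ne μ c₂ c₃ hκ.le hbig
  -- Step B: (eq9.74) ⇒ (eq9.75')
  have hκ2 : κ ^ 2 ≤ 1 := by nlinarith
  obtain ⟨b, b', hb, hb', hB⟩ := exists_bilinear_phase_average S hS hρ₁ hρ₁8 hρ₂0 hκ2 hsmall hreg₁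
    hadd (fun v => c₂ (v + x₁)) (fun v => c₃ (v + x₁)) (fun v => hc₂ _) (fun v => hc₃ _)
    (by simpa only [add_right_comm] using hA)
  -- Step C: a popular difference
  have haddB₂ : ∀ y ∈ B₂, ∀ y' ∈ B₂, μ (y' - y) + μ y = μ y' := by
    intro y hy y' hy'
    have h1 : ∀ ξ ∈ S, ‖ZMod.toAddCircle ((y' - y) * ξ)‖ ≤ 1 / 4 := fun ξ hξ => by
      rw [sub_mul, map_sub]
      exact (norm_sub_le _ _).trans (by linarith [hB₂mem y hy ξ hξ, hB₂mem y' hy' ξ hξ])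
    have := hadd (y' - y) y h1 (fun ξ hξ => (hB₂mem y hy ξ hξ).le.trans (by linarith))
      (fun ξ hξ => by rw [sub_add_cancel]; exact (hB₂mem y' hy' ξ hξ).le.trans (by linarith))
    rw [sub_add_cancel] at this
    exact this.symm
  have hB' : κ ^ 2 / 2 * (#B₂ : ℝ) ^ 2 ≤ ‖∑ x ∈ B₂, ∑ y ∈ B₂, b x * b' y *
      ((AddCircle.toCircle (ZMod.toAddCircle (μ x * y) - ZMod.toAddCircle (μ y * x)) : Circle) : ℂ)‖ := by
    refine hB.trans (le_of_eq ?_)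
    congr 1
    refine sum_congr rfl fun x _ => sum_congr rfl fun y _ => ?_
    rw [← map_sub]; rfl
  obtain ⟨y', hy', hpop⟩ := exists_popular_difference B₂ hB₂ne μ haddB₂ b b' (fun x _ => hb x)
    (fun y _ => hb' y) (by positivity : 0 < κ ^ 2 / 2) hB'
  -- Step D: the endgame
  have hc : (κ ^ 2 / 2) ^ 2 / 2 = κ ^ 4 / 8 := by ring
  rw [hc] at hpop
  have hc₁ : 0 < κ ^ 4 / 8 := by positivity
  have hc₁1 : κ ^ 4 / 8 ≤ 1 := by nlinarith
  obtain ⟨ρ', F, hρ', hF, hend⟩ := symmetry_endgame S hS hρ₂0 hρ₂64 hc₁ hc₁1 hc₁ hc₁1 hreg₂ hadd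
    (hB₂mem y' hy') (filter_subset _ _) hpop (fun y hy => (mem_filter.mp hy).2)
  exact ⟨ρ₂, ρ', F, hρ₂1, hρ', hF, hend⟩

/-- **Bridge from arXiv Prop. 45 to the input (eq9.72) of `symmetry_of_derivative`.**  For real
`f`, `N · |(Δ_{x₀+h} f)^(ξ₀ + μh)| = |Σ_x c₂(x+h) c₃(x) e(−μ(h)x/N)|` with `c₂(v) = f(v + x₀)` and
`c₃(x) = f(x) e(−xξ₀/N)` (both bounded by `1` when `|f| ≤ 1`). [folklore] -/
theorem norm_sum_deriv_eq_mul_norm_dftCoeff (f : ZMod N → ℝ) (x₀ ξ₀ h : ZMod N)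
    (μ : ZMod N → ZMod N) :
    ‖∑ x : ZMod N, ((f (x + h + x₀) : ℝ) : ℂ) * (((f x : ℝ) : ℂ) * stdAddChar (-(x * ξ₀))) *
        stdAddChar (-(μ h * x))‖ =
      N * ‖dftCoeff (fun y => f y * f (y + (x₀ + h))) (ξ₀ + μ h)‖ := by
  have hN : (N : ℝ) ≠ 0 := by exact_mod_cast NeZero.ne N
  unfold dftCoeff
  rw [norm_div, Complex.norm_natCast, mul_div_cancel₀ _ hN]
  congr 1
  refine sum_congr rfl fun x _ => ?_
  push_cast
  have : (stdAddChar (-(x * ξ₀)) : ℂ) * stdAddChar (-(μ h * x)) = stdAddChar (-(x * (ξ₀ + μ h))) := by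
    rw [← AddChar.map_add_eq_mul]; congr 1; ring
  calc ((f (x + h + x₀) : ℝ) : ℂ) * (((f x : ℝ) : ℂ) * stdAddChar (-(x * ξ₀))) * stdAddChar (-(μ h * x))
      = (f x : ℂ) * (f (x + h + x₀) : ℂ) * ((stdAddChar (-(x * ξ₀)) : ℂ) * stdAddChar (-(μ h * x))) := by
        ring
    _ = (f x : ℂ) * (f (x + (x₀ + h)) : ℂ) * stdAddChar (-(x * (ξ₀ + μ h))) := by
        rw [this, show x + h + x₀ = x + (x₀ + h) by ring]

end Summit.Parity.GeneralizedHardyLittlewood.GreenTaoLevelTwoGITwoCyclicInverse
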